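import Summits.ResolutionOfSingularities.ResolutionOfSingularities.Theorems.HilbertSamuelEliminationSigmaMaxModificationsCorridor3SigmaRowRunPFrameGood
import Summits.ResolutionOfSingularities.ResolutionOfSingularities.Theorems.HilbertSamuelEliminationSigmaMaxModificationsCorridor3SigmaRowRunPFrameLaws
import HarnessLib

/-!
# [OURS · L1 W4.2] ENGINE-I «ROW-P» — THE INSTANCE, FILE C′ (kernel lane): the transport laws of the SCOPED instance `RowRunFrame.ofRowGood` /
# `RowEngine.incidenceGood` — `eta_antitone`, `E_total`, `Eminus_nonempty`, `dbl_nonempty` PROVED; `GuardedLaws` ASSEMBLED from FIVE geometric laws stated over GOOD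
# states only (res-L1-w42-tri-2 (B-1): satisfiable hypotheses); no-reactivation and well-foundedness for the scoped instance
# (cell res-hironaka, LADDER-RESOLUTION rung L; slot W4.2, crux chain w42 `SigmaMaxModificationsCorridor3` stmt-ResolutionOfSingularities-19249 / crux
# stmt-…-18506; RULING v3.14-51a (51a-F), res-plan-2 DEAL #81 (1) → seat res-D-pv-060 g9; `--supports stmt-ResolutionOfSingularities-19249 --as helper`, counted 0)

HONEST FRAMING. OURS proof bookkeeping over FILE A/A′/C (`…RowRunPFrame`, `…RowRunPFrameGood`, `…RowRunPFrameLaws`) and PART 1/2′. SUPERSEDES BY NAME the two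
vacuous assemblies of FILE C (`RowEngine.guardedLaws_incidence`, `RowEngine.doneN_reach_incidence`: hypotheses over ALL row states, refutable — tri-2 (B-1)).
Cutkosky 2009 [Cutkosky2009] enters only as cited shapes and as the nine node HYPOTHESES by F-number; nothing here is a statement of H. Hironaka's manuscript
[Hironaka2017] (CANDIDATE, never a premise). Every declaration a PROVED `theorem`; no `def`, no named fact. AI-written, weaker than expert review.

* `RowEngine.incidenceGood_eta_antitone` / `_E_total` — the two transport laws PROVED for the scoped instance (FILE C's `eta_blowupAlong_le`,
  `mem_boundarySet_blowupAlong`); `RowEngine.incidenceGood_Eminus_nonempty` — PROVED (live components are non-empty by definition);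
* **`RowEngine.guardedLaws_incidenceGood`** — `GuardedLaws` of `(incidenceGood rd sc).toPIncidence` from FIVE named laws over good states: `η ≤ 3`
  (≤ 3 live snc `E⁻`-members through a point of a regular threefold — TRUE on the intended scope, hence satisfiable), `dbl_map` / `Eminus_map` (member / double-
  curve transforms map ONTO when meeting `T′`, (V5-4)), `surf_map` / `freeCurve_map` / `curveComp_nonempty` (laws OF THE READINGS `rd`, tri-1 (n1): hypotheses,
  never assumed); `dbl_nonempty` derived from `curveComp_nonempty`;
* `RowEngine.doneN_reach_incidenceGood` — NO-REACTIVATION along the scoped instance (PART 2′ `GuardedLaws.doneN_reach`);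
* `RowRunFrame.ofRowGood_wellFounded_flip_move` — PART 1's well-founded form with `det` DISCHARGED (`ofRowGood_det`), nine F-nodes by F-number.

References: Cutkosky, Amer. J. Math. 131 (2009), Def. 5.4–5.5, Lemma 5.1 (1), Thm 7.2 [Cutkosky2009] (shapes only).
-/

set_option linter.dupNamespace false -- mandated namespace of this single-conjunct summit

noncomputable section

open CategoryTheory AlgebraicGeometry TopologicalSpace
open Literature.AlgebraicGeometry.Resolution Literature.AlgebraicGeometry.Cutkosky2009.DatumReduction
open Summit.ResolutionOfSingularities.ResolutionOfSingularities.Theorems.SigmaMaxModificationsCorridor3.Sigma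

namespace Summit.ResolutionOfSingularities.ResolutionOfSingularities.Theorems.SigmaMaxModificationsCorridor3.RowRunP

universe u

namespace RowEngine

variable {m S₀ : ℕ} (eng : RowEngine.{u} m S₀) (rd : RowReadings.{u}) (sc : eng.Scope)

/-- **(SIM-5) `eta_antitone` for the scoped instance, PROVED** (at every point of the blow-up). [cite: Cutkosky2009, Def. 5.5 p. 18] -/
theorem incidenceGood_eta_antitone {s s' : (RowRunFrame.ofRowGood m S₀ eng sc).St} (h : (RowRunFrame.ofRowGood m S₀ eng sc).Move s s')
    (q : ULift.{u + 1} s'.1.W) :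
    (eng.incidenceGood rd sc).η s' q ≤ (eng.incidenceGood rd sc).η s ((RowRunFrame.ofRowGood m S₀ eng sc).ptMap h q) := by
  obtain ⟨s', hg'⟩ := s'
  have e : s' = eng.next s.1 := ((eng.move_iff _ _).mp h).2
  subst e
  exact RowState.eta_blowupAlong_le m S₀ s.1 (eng.γ s.1) (eng.ln_blowup s.1) _ q

/-- **`E_total` for the scoped instance, PROVED.** [folklore] -/
theorem incidenceGood_E_total {s s' : (RowRunFrame.ofRowGood m S₀ eng sc).St} (h : (RowRunFrame.ofRowGood m S₀ eng sc).Move s s')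
    (q : ULift.{u + 1} s'.1.W) (hq : (RowRunFrame.ofRowGood m S₀ eng sc).ptMap h q ∈ (eng.incidenceGood rd sc).E s) :
    q ∈ (eng.incidenceGood rd sc).E s' := by
  obtain ⟨s', hg'⟩ := s'
  have e : s' = eng.next s.1 := ((eng.move_iff _ _).mp h).2
  subst e
  exact RowState.mem_boundarySet_blowupAlong m S₀ s.1 (eng.γ s.1) (eng.ln_blowup s.1) _ q hq

/-- **`Eminus_nonempty` for the scoped instance, PROVED** (live components). [cite: Cutkosky2009, Def. 5.4 p. 18] -/
theorem incidenceGood_Eminus_nonempty (s : (RowRunFrame.ofRowGood m S₀ eng sc).St) (Fc : Set (ULift.{u + 1} s.1.W))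
    (h : Fc ∈ (eng.incidenceGood rd sc).Eminus s) : Fc.Nonempty :=
  s.1.nonempty_of_mem_eminusLive h

/-- [OURS · L1 W4.2] **THE GUARDED TRANSPORT LAWS OF THE SCOPED INSTANCE, ASSEMBLED** — three laws PROVED, five GEOMETRIC laws as named hypotheses OVER GOOD STATES
(satisfiable on the intended scope; supersedes FILE C's `guardedLaws_incidence`). [cite: Cutkosky2009, Def. 5.5, Lemma 5.1 (1)] -/
theorem guardedLaws_incidenceGood
    (eta_le_three : ∀ (s : (RowRunFrame.ofRowGood m S₀ eng sc).St) (x : ULift.{u + 1} s.1.W), s.1.eta x ≤ 3)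
    (dbl_map : ∀ {s s' : (RowRunFrame.ofRowGood m S₀ eng sc).St} (h : (RowRunFrame.ofRowGood m S₀ eng sc).Move s s')
      (D' : Set (ULift.{u + 1} s'.1.W)), D' ∈ rd.dblCurves s'.1 → (D' ∩ (RowRunFrame.ofRowGood m S₀ eng sc).T s').Nonempty →
      ∃ D ∈ rd.dblCurves s.1, (RowRunFrame.ofRowGood m S₀ eng sc).ptMap h '' D' = D)
    (Eminus_map : ∀ {s s' : (RowRunFrame.ofRowGood m S₀ eng sc).St} (h : (RowRunFrame.ofRowGood m S₀ eng sc).Move s s')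
      (Fc' : Set (ULift.{u + 1} s'.1.W)), Fc' ∈ s'.1.eminusLive → (Fc' ∩ (RowRunFrame.ofRowGood m S₀ eng sc).T s').Nonempty →
      ∃ Fc ∈ s.1.eminusLive, (RowRunFrame.ofRowGood m S₀ eng sc).ptMap h '' Fc' = Fc)
    (surf_map : ∀ {s s' : (RowRunFrame.ofRowGood m S₀ eng sc).St} (h : (RowRunFrame.ofRowGood m S₀ eng sc).Move s s')
      (S' : Set (ULift.{u + 1} s'.1.W)), S' ∈ rd.surfCompsIn s'.1 ((RowRunFrame.ofRowGood m S₀ eng sc).T s') →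
      (RowRunFrame.ofRowGood m S₀ eng sc).ptMap h '' S' ∈ rd.surfCompsIn s.1 ((RowRunFrame.ofRowGood m S₀ eng sc).T s))
    (freeCurve_map : ∀ {s s' : (RowRunFrame.ofRowGood m S₀ eng sc).St} (h : (RowRunFrame.ofRowGood m S₀ eng sc).Move s s')
      (C' : Set (ULift.{u + 1} s'.1.W)), C' ∈ (eng.incidenceGood rd sc).freeCurves s' →
      ¬ (rd.surfCompsIn s.1 ((RowRunFrame.ofRowGood m S₀ eng sc).T s)).Nonempty →
      (RowRunFrame.ofRowGood m S₀ eng sc).ptMap h '' C' ∈ rd.curveCompsIn s.1 ((RowRunFrame.ofRowGood m S₀ eng sc).T s))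
    (curveComp_nonempty : ∀ (s : (RowRunFrame.ofRowGood m S₀ eng sc).St) (A C : Set (ULift.{u + 1} s.1.W)), C ∈ rd.curveCompsIn s.1 A → C.Nonempty) :
    (eng.incidenceGood rd sc).toPIncidence.GuardedLaws where
  eta_le_three := eta_le_three
  eta_antitone h q _ := eng.incidenceGood_eta_antitone rd sc h q
  dbl_map := dbl_map
  Eminus_map := Eminus_map
  dbl_nonempty s D hD := by
    obtain ⟨I, -, I', -, -, hDc⟩ := hD
    exact curveComp_nonempty s _ D hDc
  Eminus_nonempty s Fc h := eng.incidenceGood_Eminus_nonempty rd sc s Fc h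
  E_total h q hq := eng.incidenceGood_E_total rd sc h q hq
  surf_map := surf_map
  freeCurve_map := freeCurve_map
  curveComp_nonempty := curveComp_nonempty

/-- **NO-REACTIVATION along the scoped instance** (PART 2′ `GuardedLaws.doneN_reach`), granted the five named geometric laws over good states.
[cite: Cutkosky2009, Thm 7.2 proof p. 21–23] -/
theorem doneN_reach_incidenceGood
    (eta_le_three : ∀ (s : (RowRunFrame.ofRowGood m S₀ eng sc).St) (x : ULift.{u + 1} s.1.W), s.1.eta x ≤ 3)
    (dbl_map : ∀ {s s' : (RowRunFrame.ofRowGood m S₀ eng sc).St} (h : (RowRunFrame.ofRowGood m S₀ eng sc).Move s s')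
      (D' : Set (ULift.{u + 1} s'.1.W)), D' ∈ rd.dblCurves s'.1 → (D' ∩ (RowRunFrame.ofRowGood m S₀ eng sc).T s').Nonempty →
      ∃ D ∈ rd.dblCurves s.1, (RowRunFrame.ofRowGood m S₀ eng sc).ptMap h '' D' = D)
    (Eminus_map : ∀ {s s' : (RowRunFrame.ofRowGood m S₀ eng sc).St} (h : (RowRunFrame.ofRowGood m S₀ eng sc).Move s s')
      (Fc' : Set (ULift.{u + 1} s'.1.W)), Fc' ∈ s'.1.eminusLive → (Fc' ∩ (RowRunFrame.ofRowGood m S₀ eng sc).T s').Nonempty →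
      ∃ Fc ∈ s.1.eminusLive, (RowRunFrame.ofRowGood m S₀ eng sc).ptMap h '' Fc' = Fc)
    (surf_map : ∀ {s s' : (RowRunFrame.ofRowGood m S₀ eng sc).St} (h : (RowRunFrame.ofRowGood m S₀ eng sc).Move s s')
      (S' : Set (ULift.{u + 1} s'.1.W)), S' ∈ rd.surfCompsIn s'.1 ((RowRunFrame.ofRowGood m S₀ eng sc).T s') →
      (RowRunFrame.ofRowGood m S₀ eng sc).ptMap h '' S' ∈ rd.surfCompsIn s.1 ((RowRunFrame.ofRowGood m S₀ eng sc).T s))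
    (freeCurve_map : ∀ {s s' : (RowRunFrame.ofRowGood m S₀ eng sc).St} (h : (RowRunFrame.ofRowGood m S₀ eng sc).Move s s')
      (C' : Set (ULift.{u + 1} s'.1.W)), C' ∈ (eng.incidenceGood rd sc).freeCurves s' →
      ¬ (rd.surfCompsIn s.1 ((RowRunFrame.ofRowGood m S₀ eng sc).T s)).Nonempty →
      (RowRunFrame.ofRowGood m S₀ eng sc).ptMap h '' C' ∈ rd.curveCompsIn s.1 ((RowRunFrame.ofRowGood m S₀ eng sc).T s))
    (curveComp_nonempty : ∀ (s : (RowRunFrame.ofRowGood m S₀ eng sc).St) (A C : Set (ULift.{u + 1} s.1.W)), C ∈ rd.curveCompsIn s.1 A → C.Nonempty)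
    {s s' : (RowRunFrame.ofRowGood m S₀ eng sc).St} (hr : (RowRunFrame.ofRowGood m S₀ eng sc).Reach s s') (k : ℕ)
    (hs : (eng.incidenceGood rd sc).toPIncidence.DoneN k s) : (eng.incidenceGood rd sc).toPIncidence.DoneN k s' :=
  (eng.guardedLaws_incidenceGood rd sc eta_le_three dbl_map Eminus_map surf_map freeCurve_map curveComp_nonempty).doneN_reach hr k hs

end RowEngine

namespace RowRunFrame

variable (m S₀ : ℕ) (eng : RowEngine.{u} m S₀) (sc : eng.Scope)

/-- **The scoped instance admits no infinite run; its converse step relation is well founded** — PART 1's `wellFounded_flip_move` with `det` DISCHARGED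
(`ofRowGood_det`); the nine node hypotheses stay BY F-NUMBER (bridge `RowState.toResDatum` = FILE D). [OURS · L1 W4.2] -/
theorem ofRowGood_wellFounded_flip_move
    (hF63c_thm72 : Node.Thm72 (RowRunFrame.ofRowGood m S₀ eng sc).toSig56) (hF63c_alg9 : Node.Alg9 (RowRunFrame.ofRowGood m S₀ eng sc).toSig56)
    (hF63c_infGenuine : Node.InfGenuine (RowRunFrame.ofRowGood m S₀ eng sc).toSig56) (hGglob : Node.ZR (RowRunFrame.ofRowGood m S₀ eng sc).toSig56)
    (hF63a_tauMono : Node.TauMono (RowRunFrame.ofRowGood m S₀ eng sc).toSig56)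
    (hF63a_tauRange : Node.TauRange (RowRunFrame.ofRowGood m S₀ eng sc).toSig56)
    (hF63a_tau3 : Node.Tau3 (RowRunFrame.ofRowGood m S₀ eng sc).toSig56) (hF63b_sec9 : Node.Sec9 (RowRunFrame.ofRowGood m S₀ eng sc).toSig56)
    (hF63_thm1018 : Node.Thm1018 (RowRunFrame.ofRowGood m S₀ eng sc).toSig56) :
    WellFounded (flip (RowRunFrame.ofRowGood m S₀ eng sc).Move) :=
  (RowRunFrame.ofRowGood m S₀ eng sc).wellFounded_flip_move (fun h₁ h₂ => RowRunFrame.ofRowGood_det m S₀ eng sc h₁ h₂) hF63c_thm72 hF63c_alg9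
    hF63c_infGenuine hGglob hF63a_tauMono hF63a_tauRange hF63a_tau3 hF63b_sec9 hF63_thm1018

end RowRunFrame

end Summit.ResolutionOfSingularities.ResolutionOfSingularities.Theorems.SigmaMaxModificationsCorridor3.RowRunP

end
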